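import Literature.IUT.HodgeTheaters.PuncturedEllipticCoveringsCor12OfOriginLaws
import HarnessLib

/-!
# [IUTchI] §1: the GEOMETRIC ORIGIN RECORD of a `PuncturedEllipticData` — the classical structure of
# `Δ_C ⊇ Δ_X` for `X = E ∖ {O}` a once-punctured elliptic curve and `C = X/{±1}` — and Cor. 1.2 over it

Mochizuki, *Inter-universal Teichmüller theory I*, kurims manuscript (May 2020), §1 p. 37 ("Let `X` be a hyperbolic curve
of type `(1,1)` over a field `k` of characteristic zero; `C` a hyperbolic orbicurve of type `(1,1)_±` … the quotient of
`X` by the unique `k`-involution `−1`"; "`ε⁰` for the unique zero cusp of `X`") and Cor. 1.2 p. 39 [cite: Mochizuki2012,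
IUTchI §1 pp.37-39] (D-0012 claim key; series status DISPUTED — nothing of the series is asserted here); A. Grothendieck,
SGA 1 Exp. XIII Cor. 2.12 (the geometric fundamental group of an affine curve of genus `g` with `r ≥ 1` punctures over an
algebraically closed field of characteristic `0` is free profinite of rank `2g + r − 1`); S. Mochizuki, *Topics in Absolute
Anabelian Geometry I*, Lemma 4.5 (i) p. 54 ("free pro-`Σ`", the tree's `IsFreeProOn`) [cite: MochizukiAbsTopI2012, Lemma
4.5 (i) p.54]; *Topics III*, Prop. 1.4 (i) p. 31 (cusp inertia of a once-punctured torus = the closed procyclic subgroup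
on the commutator of the two free generators) [cite: MochizukiAbsTopIII2015, Prop 1.4 (i) p.31]; *Topics II*, Rmk. 3.1.1 /
Cor. 3.3 (ii) p. 68 (the semi-elliptic orbicurve and its unique double cover by a curve) [cite: MochizukiAbsTopII2013,
Cor 3.3 (ii) p.68].

DEFINITION file (cell abc-iut, seat abc-iut-L5-t1 gen 11 = the `PuncturedEllipticData` lineage; L5 ROWS #5 R6
«COR12-ORIGIN-OBJECT-DEFS», GAP-LEDGER G-L5t1g11-1, G-L5t1g11-2, G-L5t1g11-3; policy (P2′) as for abc-iut-L3's `SpecialFibreTower.PiData`).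
abc-iut-L5-t1's `PuncturedEllipticData` (p404449) is an INTERFACE: it records `Π_C ↠ G_k`, the open subgroups `Π_X`,
`Π_C̲`, the assumption (∗) and four named cusps — and NO presentation of the geometric groups `Δ_C ⊇ Δ_X`.  The printed
proof of Cor. 1.2 uses classical structure facts about those groups; tonight's closer chain (p491635 → p492999 → p494126
(abc-iut-f-090) → p494272 → p494944) reduced them to THREE origin-shaped inputs, displayed as binders.  This file
packages exactly those three as ONE successor ORIGIN RECORD — "the datum IS the étale fundamental group of a
once-punctured elliptic curve and of its quotient by `−1`" — whose fields quote the classical statements (record-laws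
printed beside; nothing asserts that a record EXISTS for a given datum — that is the after-merge object at the
étale-`π₁` model, FOUNDATIONS row 12):
* `PuncturedEllipticData.GeomOrigin D` — fields (A) `gens`, `isFreeProOn` («`Δ_X ≅ F̂₂`»), (c′)
  `inertia_eq_conj_commutator` («every cusp inertia group of `X̲` is a `Δ_X`-conjugate of `⟨[a,b]⟩⁻`» — LITERALLY the
  binder `hcusp` of abc-iut-f-090's p494126), (e) `deltaC_le_closure_torsion` («`Δ_C` is topologically generated by its
  elements of finite order», `Δ_C ≅ (ℤ/2 ∗ ℤ/2 ∗ ℤ/2)^` — LITERALLY the binder `hgenC` of p494272);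
* §2 (proof-only) the consequences BY NAME: `GeomOrigin.relIndex_H_eq_sq` (`hrank`), `.geomTFG` ([AbsTopI] Prop. 2.2 at
  the core, F-0240), `.torsionFree_deltaX` (print's "`X` is a scheme"), `.huniq` ([AbsTopII] Cor. 3.3 (ii) uniqueness,
  print form), `.inertia_le_H` (`hIH`) [at any record, `Δ_X` is NOT Mathlib-`IsMulTorsionFree`: abc-iut-L4-t12's
  Summits-side `cor12_htf_false_of_isFreeProOn`, p493804 — FINDING T1g11-F1; not importable here];
* §3 the Cor. 1.2 closer over two records: `InitialThetaData.pe_characteristicNatureOfCoverings_of_geomOrigin (O O′)` =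
  p494944's `…_of_originLaws` with the four origin binders MOVED INTO the records; displayed: DATA `C C′ A O O′` · FACT
  `hA hA′` (F-0206) · GAP `h0 h0′` (G-L5d4g6-1) · LAW `hL L′` (`ModLCuspLaws`), `hext hextC` ([AbsTopII] Cor. 3.3 (i)).

HONEST FRAMING: a hypothesis/ORIGIN record, asserted for no instance (no §1 datum in the tree has a free profinite `Δ_X`;
field (A) alone is non-vacuous by abc-iut-L4's `isFreeProOn_profiniteCompletion_freeGroup`); no instance, no notation, no
`Prop`-valued `def`; nothing here bears on [IUTchIII] Cor. 3.12 or asserts that abc is proved or refuted; typed ≠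
inhabited ≠ discharged.
-/

noncomputable section

namespace Literature.IUT.HodgeTheaters

namespace PuncturedEllipticData

open scoped Pointwise
open Literature.AnabelianGeometry.AbsoluteAnabelian

universe u

variable {D : PuncturedEllipticData.{u}}

/-- **The geometric ORIGIN RECORD of a `PuncturedEllipticData`** ([IUTchI] §1 p. 37: `X` a once-punctured elliptic curve
over `k` of characteristic `0`, `C = X/{±1}`): the classical structure of the geometric fundamental groups `Δ_X ⊆ Δ_C` that
the interface does not carry — (A) `Δ_X` is FREE PROFINITE on two generators `a, b` [SGA1 XIII Cor. 2.12; [AbsTopI]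
Lem. 4.5 (i)]; (c′) every cusp inertia group of `X̲` (all cusps of `X̲` lie over the one cusp of `X`, unramified) is a
`Δ_X`-conjugate of the closed procyclic subgroup on `[a,b]` [[AbsTopIII] Prop. 1.4 (i)]; (e) `Δ_C` is topologically
generated by its elements of finite order [`C` is `ℙ¹` minus a point with three orbifold points of order `2`:
`Δ_C ≅ (ℤ/2 ∗ ℤ/2 ∗ ℤ/2)^`; [AbsTopII] Rmk. 3.1.1].  A HYPOTHESIS record: asserted for no datum (GAP-LEDGER G-L5t1g11-1, G-L5t1g11-2, G-L5t1g11-3).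
[cite: Mochizuki2012, IUTchI §1 p.37] -/
structure GeomOrigin (D : PuncturedEllipticData.{u}) : Type u where
  /-- (A) two topological generators `a = gens 0`, `b = gens 1` of `Δ_X = Π_X ∩ Δ_C` … -/
  gens : Fin 2 → ↥(D.PiX ⊓ D.DeltaC)
  /-- (A) … on which `Δ_X` is free profinite ([SGA1 XIII 2.12]: `π₁` of a once-punctured elliptic curve over an
  algebraically closed field of characteristic `0` is `F̂₂`; [AbsTopI] Lem. 4.5 (i) vocabulary). -/
  isFreeProOn : IsFreeProOn ↥(D.PiX ⊓ D.DeltaC) Set.univ gens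
  /-- (c′) every cusp inertia group `I_x ⊆ Δ_C` of a cusp `x` of `X̲` is a `Δ_X`-conjugate of the closed procyclic
  subgroup generated by the commutator `[a, b]` (the inertia of the cusp `O` of `X`, [AbsTopIII] Prop. 1.4 (i); the
  cusps of `X̲` lie over `O`). -/
  inertia_eq_conj_commutator : ∀ x : D.Cusp, ∃ g ∈ D.PiX ⊓ D.DeltaC,
    D.inertia x = (Subgroup.zpowers (g * ((gens 0 : D.PiC) * (gens 1 : D.PiC) * (gens 0 : D.PiC)⁻¹ *
      (gens 1 : D.PiC)⁻¹) * g⁻¹)).topologicalClosure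
  /-- (e) `Δ_C` is topologically generated by its elements of finite order (`C = X/{±1}`: `Δ_C` is the profinite
  completion of `ℤ/2 ∗ ℤ/2 ∗ ℤ/2`, generated by three involutions; [AbsTopII] Rmk. 3.1.1). -/
  deltaC_le_closure_torsion :
    D.DeltaC ≤ (Subgroup.closure {g : D.PiC | g ∈ D.DeltaC ∧ IsOfFinOrder g}).topologicalClosure

namespace GeomOrigin

/-! ### §2. The classical consequences, BY NAME -/

/-- `[Δ_X : H] = l²` for `H = Ker(Δ_X ↠ Δ_X^{ab} ⊗ ℤ/lℤ)` (the law `hrank` of the Cor. 1.2 closers; p491635).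
([IUTchI] §1 p.37) [claim: Mochizuki2012, status: disputed] -/
theorem relIndex_H_eq_sq (O : D.GeomOrigin) :
    (⁅D.PiX ⊓ D.DeltaC, D.PiX ⊓ D.DeltaC⁆ ⊔ Subgroup.closure
      ((fun y : D.PiC => y ^ D.l) '' (D.PiX ⊓ D.DeltaC : Set D.PiC))).topologicalClosure.relIndex
        (D.PiX ⊓ D.DeltaC) = D.l ^ 2 :=
  D.relIndex_H_eq_sq_of_isFreeProOn O.isFreeProOn

/-- [AbsTopI] Prop. 2.2 `GeomTFG` of the `k`-core (FACT-LIST F-0240 at the instance), from (A) (p491635).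
([IUTchI] Cor 1.2 p.39) [claim: Mochizuki2012, status: disputed] -/
theorem geomTFG (O : D.GeomOrigin) : D.E.GeomTFG := D.geomTFG_of_isFreeProOn O.isFreeProOn

/-- Print's "`Δ_X` is torsion-free" (`X` a scheme, [AbsTopI] Lem. 4.1 (iv)), from (A) (p491635).
([IUTchI] Cor 1.2 p.39) [claim: Mochizuki2012, status: disputed] -/
theorem torsionFree_deltaX (O : D.GeomOrigin) : ∀ g : ↥(D.PiX ⊓ D.DeltaC), IsOfFinOrder g → g = 1 :=
  D.torsionFree_deltaX_of_isFreeProOn O.isFreeProOn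

/-- The [AbsTopII] Cor. 3.3 (ii) / Rmk. 3.1.1 uniqueness of the double cover of `C` by a curve, print's torsion-free form
(the law `huniq`), from (e) + (A) (p494272). ([IUTchI] Cor 1.2 p.39) [claim: Mochizuki2012, status: disputed] -/
theorem huniq (O : D.GeomOrigin) : ∀ J : Subgroup D.PiC, IsOpen (J : Set D.PiC) → J.index = 2 →
    (∀ g : ↥(J ⊓ D.DeltaC), IsOfFinOrder g → g = 1) → J ⊓ D.DeltaC = D.PiX ⊓ D.DeltaC :=
  D.huniq_of_torsionGenerated_of_isFreeProOn O.deltaC_le_closure_torsion O.isFreeProOn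

/-- Every cusp inertia group of `X̲` lies in `H = Ker(Δ_X ↠ Δ_X^{ab} ⊗ ℤ/lℤ)` (the law `hIH`), from (c′)
(abc-iut-f-090 p494126). ([IUTchI] §1 p.37) [claim: Mochizuki2012, status: disputed] -/
theorem inertia_le_H (O : D.GeomOrigin) : ∀ x : D.Cusp, D.inertia x ≤
    (⁅D.PiX ⊓ D.DeltaC, D.PiX ⊓ D.DeltaC⁆ ⊔ Subgroup.closure
      ((fun y : D.PiC => y ^ D.l) '' (D.PiX ⊓ D.DeltaC : Set D.PiC))).topologicalClosure :=
  D.inertia_le_H_of_commutatorCusp_gens O.gens O.inertia_eq_conj_commutator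

end GeomOrigin

end PuncturedEllipticData

/-! ### §3. Cor. 1.2 at the genuine `K`-level data over two origin records -/

namespace InitialThetaData

open scoped Pointwise
open Literature.AnabelianGeometry.AbsoluteAnabelian
open Literature.AnabelianGeometry.AbsoluteAnabelian.FundamentalExtension (CuspidalAlgorithm)

universe u u'

variable {F : Type u} {K : Type} {Fbar : Type} [Field F] [NumberField F] [Field K] [NumberField K]
  [Algebra F K] [Field Fbar] [Algebra F Fbar] [Algebra K Fbar]
  {E : WeierstrassCurve F} [E.IsElliptic] {l : ℕ} {Pb : BadPlacePredicates K}
  (D : InitialThetaData F K Fbar E l Pb)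
  {F' : Type u'} {K' : Type} [Field F'] [NumberField F'] [Field K'] [NumberField K'] [Algebra F' K']
  {Fbar' : Type} [Field Fbar'] [Algebra F' Fbar'] [Algebra K' Fbar']
  {E' : WeierstrassCurve F'} [E'.IsElliptic] {l' : ℕ} {Pb' : BadPlacePredicates K'}
  (D' : InitialThetaData F' K' Fbar' E' l' Pb')

/-- **[IUTchI] Cor. 1.2 between the `K`-level data of two initial Θ-data carrying geometric ORIGIN RECORDS `O`, `O′`**:
p494944's `pe_characteristicNatureOfCoverings_of_originLaws` with the origin binders `hfree hfree′ hcusp′ hgenC′` moved into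
the records.  Displayed binders: DATA `C C′ A O O′`; FACT `hA hA′` ([AbsTopI] Lem. 4.5 (v), F-0206); GAP `h0 h0′`
(ramification of `ε⁰`, G-L5d4g6-1); LAW `hL L′` (abc-iut-L5-t1's printed `Δ_ε`-level laws `ModLCuspLaws`), `hext hextC`
([AbsTopII] Cor. 3.3 (i) extension form). ([IUTchI] Cor 1.2 p.39) [claim: Mochizuki2012, status: disputed] -/
theorem pe_characteristicNatureOfCoverings_of_geomOrigin
    (O : D.geom.pe.GeomOrigin) (O' : D'.geom.pe.GeomOrigin)
    (C : D.geom.pe.CuspGalois) (C' : D'.geom.pe.CuspGalois)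
    (hL : D.geom.pe.ModLCuspLaws) (L' : D'.geom.pe.ModLCuspLaws)
    (h0 : ¬ D.geom.pe.inertia D.geom.pe.ε0 ≤ D.geom.pe.piXarrow)
    (h0' : ¬ D'.geom.pe.inertia D'.geom.pe.ε0 ≤ D'.geom.pe.piXarrow)
    (hext : ∀ φ : D.geom.pe.piXarrow ≃* D'.geom.pe.piXarrow, Continuous φ → Continuous φ.symm →
      ∃ Θ : D.geom.pe.PiC ≃ₜ* D'.geom.pe.PiC,
        ∀ x : D.geom.pe.piXarrow, Θ (x : D.geom.pe.PiC) = (φ x : D'.geom.pe.PiC))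
    (hextC : ∀ ψ : D.geom.pe.piCarrow ≃* D'.geom.pe.piCarrow, Continuous ψ → Continuous ψ.symm →
      ∃ Θ : D.geom.pe.PiC ≃ₜ* D'.geom.pe.PiC,
        ∀ x : D.geom.pe.piCarrow, Θ (x : D.geom.pe.PiC) = (ψ x : D'.geom.pe.PiC))
    (A : CuspidalAlgorithm.{0}) (hA : A.RecoversCusps D.geom.pe.extXbar C.cuspidalDataXbar)
    (hA' : A.RecoversCusps D'.geom.pe.extXbar C'.cuspidalDataXbar) :
    D.geom.pe.CharacteristicNatureOfCoverings D'.geom.pe :=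
  D.pe_characteristicNatureOfCoverings_of_originLaws D' C C' hL L' O.isFreeProOn O'.isFreeProOn
    O'.inertia_eq_conj_commutator O'.deltaC_le_closure_torsion h0 h0' hext hextC A hA hA'

end InitialThetaData

end Literature.IUT.HodgeTheaters
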